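import Summits.Ventures.HodgeRepro2.T6Interface
import Summits.Ventures.HodgeRepro2.WeilVector

/-!
# T6-A3 — the eigenbasis model `Φ : A ι ≃ₐ[ℂ] HBC K` of `H^*(B, ℂ)` and the Weil vectors

Tier 6 (README §10), sub-goal A3, seat t6-p3; proof lane.  TIER4 §A0.6 / §A5.3: with the eigenlines
`ℓ_{i,σ} ⊂ H¹(A_i, ℂ)` and generators `e_{i,σ}` (`e_{i,σ̄} = κ(e_{i,σ})`), the twelve PLANES
`P_{i,ν} = ℂ e_{i,τ_ν} ⊕ ℂ e_{i,τ̄_ν}` (`i ∈ Fin 4` the vertex, `ν ∈ Fin 3` the real place) give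
`H¹(B, ℂ) = ⊕ P_{i,ν}` and `H^*(B, ℂ) = ⋀^* H¹(B, ℂ)` = p5's twelve-plane model
`A ι = ⋀_ℂ (ι × Bool → ℂ)`, `ι = Fin 4 × Fin 3`, generator `((i, ν), s) ↦ e_{i, τ_ν}` (`s = false`) /
`e_{i, τ̄_ν}` (`s = true`).  This file packages the A1 inputs A3 consumes (`EigenBasis`: an
enumeration of the six embeddings by (real place, conjugation bit) and an eigenvector basis of
`H¹(B, ℂ)` spanning the eigenlines of `T6Interface`), builds the model isomorphism `Φ`, proves it
is graded (the hypotheses of `T6A3IntegralModel.integralModel`), and identifies the interface's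
complex Weil space `weilC F` with the ℂ-span of the six model Weil vectors `Φ (weil (planes ν) s)`
(TIER4 Def. A1.1 / (A5.3)(d)).  Nothing here is a display.
-/

open scoped TensorProduct

namespace Summit.Ventures.HodgeRepro2.T6.A3Model

open WeilPlanes WeilIntegral WeilDetect

variable {K : Type*} [Field K] [NumberField K]

/-- The twelve planes `(i, ν)`: vertex `i ∈ Fin 4`, real place `ν ∈ Fin 3`. -/
abbrev Pl : Type := Fin 4 × Fin 3

/-- The A1 data A3 consumes: an enumeration `emb` of the embeddings `K →+* ℂ` by (real place,
conjugation bit) and an eigenvector basis `eB` of `H¹(B, ℂ)` with `eB (i, σ)` spanning the eigenline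
`ℓ_{i,σ}` of `T6Interface` (TIER4 §A0.4–§A0.6, Theorem A1(i)). -/
structure EigenBasis (K : Type*) [Field K] [NumberField K] where
  /-- the three real places with their two complex embeddings each -/
  emb : Fin 3 × Bool ≃ (K →+* ℂ)
  /-- the eigenvector basis `e_{i,σ}` of `H¹(B, ℂ)` -/
  eB : Module.Basis (Fin 4 × (K →+* ℂ)) ℂ (H1C K)
  /-- `ℓ_{i,σ} = ℂ · e_{i,σ}` -/
  eigen : ∀ (i : Fin 4) (σ : K →+* ℂ), eigenLine K i σ = Submodule.span ℂ {eB (i, σ)}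

variable (E : EigenBasis K)

/-! ## 1. The model isomorphism `Φ` -/

/-- Generators of the model ↔ basis indices: `((i, ν), s) ↦ (i, emb (ν, s))`. -/
def genIdx : Gen Pl ≃ Fin 4 × (K →+* ℂ) where
  toFun j := (j.1.1, E.emb (j.1.2, j.2))
  invFun p := ((p.1, (E.emb.symm p.2).1), (E.emb.symm p.2).2)
  left_inv j := by
    obtain ⟨⟨i, ν⟩, s⟩ := j
    simp
  right_inv p := by
    obtain ⟨i, σ⟩ := p
    simp

/-- The linear isomorphism `V Pl = (Gen Pl → ℂ) ≃ₗ[ℂ] H¹(B, ℂ)` sending the standard basis to `eB`. -/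
noncomputable def eigenEquiv : V Pl ≃ₗ[ℂ] H1C K :=
  (Pi.basisFun ℂ (Gen Pl)).equiv E.eB (genIdx E)

/-- `eigenEquiv (Pi.single j 1) = eB (genIdx j)`. -/
theorem eigenEquiv_single (j : Gen Pl) : eigenEquiv E (Pi.single j 1) = E.eB (genIdx E j) := by
  have := (Pi.basisFun ℂ (Gen Pl)).equiv_apply j E.eB (genIdx E)
  rwa [Pi.basisFun_apply] at this

/-- The isometry of zero forms induced by `eigenEquiv`. -/
noncomputable def vIsometry :
    (0 : QuadraticForm ℂ (V Pl)).IsometryEquiv (0 : QuadraticForm ℂ (H1C K)) :=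
  { eigenEquiv E with map_app' := fun _ => rfl }

/-- **The eigenbasis model** `modelEquiv = Φ : A Pl ≃ₐ[ℂ] HBC K` (TIER4 §A0.3(ii) `H^*(B, ℂ) = ⋀^* H¹(B, ℂ)` in the
basis of eigenvectors). -/
noncomputable def modelEquiv : A Pl ≃ₐ[ℂ] HBC K := CliffordAlgebra.equivOfIsometry (vIsometry E)

/-- `Φ (ι v) = ι (eigenEquiv v)`. -/
theorem modelEquiv_ι (v : V Pl) : modelEquiv E (ExteriorAlgebra.ι ℂ v) = ExteriorAlgebra.ι ℂ (eigenEquiv E v) := by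
  unfold modelEquiv
  rw [CliffordAlgebra.equivOfIsometry_apply, ExteriorAlgebra.ι, CliffordAlgebra.map_apply_ι]
  rfl

/-- `Φ (gen j) = ι (e_{genIdx j})`: the generator `((i, ν), s)` is the eigenvector `e_{i, emb (ν, s)}`. -/
theorem modelEquiv_gen (j : Gen Pl) : modelEquiv E (gen j) = ExteriorAlgebra.ι ℂ (E.eB (genIdx E j)) := by
  unfold gen
  rw [modelEquiv_ι, eigenEquiv_single]

/-- `Φ⁻¹ (ι w) = ι (eigenEquiv⁻¹ w)`. -/
theorem modelEquiv_symm_ι (w : H1C K) :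
    (modelEquiv E).symm (ExteriorAlgebra.ι ℂ w) = ExteriorAlgebra.ι ℂ ((eigenEquiv E).symm w) := by
  rw [AlgEquiv.symm_apply_eq, modelEquiv_ι, LinearEquiv.apply_symm_apply]

/-- An algebra isomorphism of exterior algebras carrying `ι` to `ι ∘ e` respects the wedge monomials. -/
theorem modelEquiv_ιMulti {n : ℕ} (v : Fin n → V Pl) :
    modelEquiv E (ExteriorAlgebra.ιMulti ℂ n v) = ExteriorAlgebra.ιMulti ℂ n (fun i => eigenEquiv E (v i)) := by
  rw [ExteriorAlgebra.ιMulti_apply, ExteriorAlgebra.ιMulti_apply, map_list_prod, List.map_ofFn]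
  exact congrArg List.prod (congrArg List.ofFn (funext fun i => modelEquiv_ι E (v i)))

/-- `Φ⁻¹` respects the wedge monomials. -/
theorem modelEquiv_symm_ιMulti {n : ℕ} (w : Fin n → H1C K) :
    (modelEquiv E).symm (ExteriorAlgebra.ιMulti ℂ n w) =
      ExteriorAlgebra.ιMulti ℂ n (fun i => (eigenEquiv E).symm (w i)) := by
  rw [ExteriorAlgebra.ιMulti_apply, ExteriorAlgebra.ιMulti_apply, map_list_prod, List.map_ofFn]
  exact congrArg List.prod (congrArg List.ofFn (funext fun i => modelEquiv_symm_ι E (w i)))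

/-- `Φ` is graded. -/
theorem modelEquiv_mem_exteriorPower (n : ℕ) (x : A Pl) (hx : x ∈ ⋀[ℂ]^n (V Pl)) :
    modelEquiv E x ∈ ⋀[ℂ]^n (H1C K) := by
  rw [← ExteriorAlgebra.ιMulti_span_fixedDegree] at hx
  induction hx using Submodule.span_induction with
  | mem x hx =>
    obtain ⟨v, rfl⟩ := hx
    rw [modelEquiv_ιMulti]
    exact ExteriorAlgebra.ιMulti_range ℂ n ⟨_, rfl⟩
  | zero => simp
  | add x y _ _ hx hy => rw [map_add]; exact Submodule.add_mem _ hx hy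
  | smul r x _ hx => rw [map_smul]; exact Submodule.smul_mem _ r hx

/-- `Φ⁻¹` is graded. -/
theorem modelEquiv_symm_mem_exteriorPower (n : ℕ) (y : HBC K) (hy : y ∈ ⋀[ℂ]^n (H1C K)) :
    (modelEquiv E).symm y ∈ ⋀[ℂ]^n (V Pl) := by
  rw [← ExteriorAlgebra.ιMulti_span_fixedDegree] at hy
  induction hy using Submodule.span_induction with
  | mem x hx =>
    obtain ⟨w, rfl⟩ := hx
    rw [modelEquiv_symm_ιMulti]
    exact ExteriorAlgebra.ιMulti_range ℂ n ⟨_, rfl⟩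
  | zero => simp
  | add x y _ _ hx hy => rw [map_add]; exact Submodule.add_mem _ hx hy
  | smul r x _ hx => rw [map_smul]; exact Submodule.smul_mem _ r hx

/-! ## 2. The embeddings of the model and the Weil vectors -/

/-- The four planes `(i, ν)`, `i ∈ Fin 4`, of the real place `ν` (the set `P₀` of `T6A3Pairing`). -/
def planes (ν : Fin 3) : Finset Pl := Finset.univ.image fun i : Fin 4 => (i, ν)

/-- Each real place has four planes (one per vertex). -/
theorem card_planes (ν : Fin 3) : (planes ν).card = 4 := by
  unfold planes
  rw [Finset.card_image_of_injective _ (fun i j h => (Prod.mk.inj h).1)]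
  simp

/-- `(i, ν') ∈ planes ν ↔ ν' = ν`. -/
theorem mem_planes (ν : Fin 3) (p : Pl) : p ∈ planes ν ↔ p.2 = ν := by
  unfold planes
  simp only [Finset.mem_image, Finset.mem_univ, true_and]
  constructor
  · rintro ⟨i, rfl⟩; rfl
  · intro h; exact ⟨p.1, by rw [← h]⟩

/-- The six embeddings of the model, as pairs (planes of the real place, conjugation bit) —
the `embeddings` of `T6A3TheoremA` / `T6A3PairingKappa`. -/
def embeddings : Finset (Finset Pl × Bool) :=
  Finset.univ.image fun νs : Fin 3 × Bool => (planes νs.1, νs.2)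

/-- Every model embedding has four planes. -/
theorem card_of_mem_embeddings (σ : Finset Pl × Bool) (hσ : σ ∈ embeddings) : σ.1.card = 4 := by
  unfold embeddings at hσ
  obtain ⟨νs, _, h⟩ := Finset.mem_image.mp hσ
  exact h ▸ card_planes νs.1

/-- Twelve planes. -/
theorem card_Pl : Fintype.card Pl = 12 := by simp [Pl]

/-- The ordered Weil vector `e_{0,σ} ∧ e_{1,σ} ∧ e_{2,σ} ∧ e_{3,σ}` of the model, `σ = (ν, s)`. -/
noncomputable def wvec (ν : Fin 3) (s : Bool) : A Pl :=
  mono [((0, ν), s), ((1, ν), s), ((2, ν), s), ((3, ν), s)]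

/-- The generator list of `wvec` is a permutation of p5's `weilList (planes ν) s`. -/
theorem wvec_list_perm (ν : Fin 3) (s : Bool) :
    [((0, ν), s), ((1, ν), s), ((2, ν), s), ((3, ν), s)].Perm
      ((planes ν).toList.map fun p : Pl => (p, s)) := by
  apply List.perm_of_nodup_nodup_toFinset_eq
  · simp [List.nodup_cons]
  · exact nodup_weilList _ _
  · ext j
    simp only [List.mem_toFinset, List.mem_cons, List.mem_nil_iff, or_false, List.mem_map,
      Finset.mem_toList, mem_planes]
    constructor
    · rintro (rfl | rfl | rfl | rfl) <;> exact ⟨_, rfl, rfl⟩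
    · rintro ⟨⟨i, ν'⟩, hp, rfl⟩
      simp only at hp
      subst hp
      fin_cases i <;> simp

/-- `wvec` is p5's `weil (planes ν) s` up to the order of the four factors (a sign). -/
theorem wvec_eq_smul_weil (ν : Fin 3) (s : Bool) :
    ∃ ε : ℂ, (ε = 1 ∨ ε = -1) ∧ wvec ν s = ε • weil (planes ν) s := by
  unfold wvec weil
  exact WeilVector.mono_perm (wvec_list_perm ν s)

/-- `Φ (wvec ν s) = ι e₀ * ι e₁ * ι e₂ * ι e₃` for the eigenvectors of `σ = emb (ν, s)`. -/
theorem modelEquiv_wvec (ν : Fin 3) (s : Bool) :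
    modelEquiv E (wvec ν s) =
      ExteriorAlgebra.ι ℂ (E.eB (0, E.emb (ν, s))) * ExteriorAlgebra.ι ℂ (E.eB (1, E.emb (ν, s))) *
        ExteriorAlgebra.ι ℂ (E.eB (2, E.emb (ν, s))) * ExteriorAlgebra.ι ℂ (E.eB (3, E.emb (ν, s))) := by
  unfold wvec mono
  simp only [List.map_cons, List.map_nil, List.prod_cons, List.prod_nil, mul_one, map_mul, modelEquiv_gen,
    mul_assoc]
  rfl

/-- The interface's complex Weil space is the span of the six model Weil vectors:
`weilC F = span_ℂ {Φ (weil (planes ν) s)}` (TIER4 Def. A1.1, Prop. A2.3(iv)). -/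
theorem weilC_eq (F : FaceSetting K) :
    weilC F = Submodule.span ℂ (Set.range fun νs : Fin 3 × Bool => modelEquiv E (weil (planes νs.1) νs.2)) := by
  -- each summand of `weilC` is a line
  have hline : ∀ σ : K →+* ℂ,
      ιW (eigenLine K 0 σ) * ιW (eigenLine K 1 σ) * ιW (eigenLine K 2 σ) * ιW (eigenLine K 3 σ) =
        Submodule.span ℂ {ExteriorAlgebra.ι ℂ (E.eB (0, σ)) * ExteriorAlgebra.ι ℂ (E.eB (1, σ)) *
          ExteriorAlgebra.ι ℂ (E.eB (2, σ)) * ExteriorAlgebra.ι ℂ (E.eB (3, σ))} := by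
    intro σ
    have hι : ∀ i : Fin 4, ιW (eigenLine K i σ) = Submodule.span ℂ {ExteriorAlgebra.ι ℂ (E.eB (i, σ))} := by
      intro i
      unfold ιW
      rw [E.eigen i σ, Submodule.map_span, Set.image_singleton]
    rw [hι 0, hι 1, hι 2, hι 3, Submodule.span_mul_span, Set.singleton_mul_singleton,
      Submodule.span_mul_span, Set.singleton_mul_singleton, Submodule.span_mul_span,
      Set.singleton_mul_singleton]
  unfold weilC
  simp_rw [hline]
  apply le_antisymm
  · refine iSup_le fun σ => ?_
    rw [Submodule.span_le, Set.singleton_subset_iff, SetLike.mem_coe]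
    obtain ⟨νs, hνs⟩ := E.emb.surjective σ
    obtain ⟨ε, hε, hw⟩ := wvec_eq_smul_weil νs.1 νs.2
    have h1 : ExteriorAlgebra.ι ℂ (E.eB (0, σ)) * ExteriorAlgebra.ι ℂ (E.eB (1, σ)) *
        ExteriorAlgebra.ι ℂ (E.eB (2, σ)) * ExteriorAlgebra.ι ℂ (E.eB (3, σ)) =
        ε • modelEquiv E (weil (planes νs.1) νs.2) := by
      rw [← map_smul, ← hw, modelEquiv_wvec, hνs]
    rw [h1]
    exact Submodule.smul_mem _ _ (Submodule.subset_span ⟨νs, rfl⟩)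
  · rw [Submodule.span_le]
    rintro _ ⟨νs, rfl⟩
    obtain ⟨ε, hε, hw⟩ := wvec_eq_smul_weil νs.1 νs.2
    have hunit : ε ≠ 0 := by rcases hε with rfl | rfl <;> norm_num
    have h1 : modelEquiv E (weil (planes νs.1) νs.2) = ε⁻¹ • modelEquiv E (wvec νs.1 νs.2) := by
      rw [hw, map_smul, smul_smul, inv_mul_cancel₀ hunit, one_smul]
    show modelEquiv E (weil (planes νs.1) νs.2) ∈ _
    rw [h1]
    refine Submodule.smul_mem _ _ (le_iSup (fun σ : K →+* ℂ => Submodule.span ℂ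
      {ExteriorAlgebra.ι ℂ (E.eB (0, σ)) * ExteriorAlgebra.ι ℂ (E.eB (1, σ)) *
        ExteriorAlgebra.ι ℂ (E.eB (2, σ)) * ExteriorAlgebra.ι ℂ (E.eB (3, σ))}) (E.emb νs) ?_)
    rw [modelEquiv_wvec]
    exact Submodule.subset_span rfl

end Summit.Ventures.HodgeRepro2.T6.A3Model
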